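import Mathlib
import Literature.Barriers.ValiantsHypothesis.AlgebraicNaturalProofs
import Literature.Computability.AlgebraicComplexity.ReadOnceFormulas
import HarnessLib

/-!
# Crux `BarrierLever.SuccinctHittingSetsForVP` (stmt-ValiantsHypothesis-14610), line `registered` —
LEMMAS for the stub `stub_readOnceGenerator` (file `…StubReadOnceGenerator.lean`): the
Shpilka–Volkovich induction for an ABSTRACT seeded generator family

**What is proved (unconditional; helper file, it does NOT close the item).**

* `ReadOnceGenerator.decomp` : a preprocessed read-once polynomial `P` (`IsPROP S P`, Minahan–Volkovich
  Def. 12) splits at every variable `μ` as `P = T(x_μ) · A + B` with `A`, `B` preprocessed read-once on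
  leaf sets inside `S ∖ {μ}` (Minahan–Volkovich Lemma 13-style structural induction).
* `ReadOnceGenerator.core` (with `heart`, `core_aux`) : Shpilka–Volkovich's theorem "the generator
  with `t` seeds hits (preprocessed) read-once polynomials on `< 2^t` variables" for an abstract family
  `G_J : ι → ℂ[V]` (`J : Finset K` the active seeds, `lam j ∈ ℂ[V]` the seed variables) having the
  three specialisation properties that the induction uses — `hσ` (AXIS of a seed `j₀ ∈ J` at a
  coordinate `μ₀`: an algebra endomorphism with `G_J ↦ G_{J∖j₀} + lam j₀ · e_{μ₀}`), `hτ` (KILL a seed: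
  `G_J ↦ G_{J∖j₀}`), `hρ` (for a fresh seed `j₀ ∉ J`, a map to `ℂ[X]` with `G_J ν ↦ y_ν`,
  `lam j₀ ↦ X`): if `IsPROP S P` and `|S| < 2^{|J|}` then `P` is a constant or `P ∘ G_J` is
  non-constant (`totalDegree ≠ 0`).

**Proof.** Induction on `|J|`, then on the formula. Leaves `T(x_μ)`, `deg T ≥ 1`: `hσ` then `hρ` send
`T(G_J μ)` to `T(y_μ + X)`, of degree `deg T` (`Polynomial.natDegree_taylor`). Products: `ℂ[V]` is a
domain (`MvPolynomial.totalDegree_mul_of_isDomain`). Sums `P + Q` on disjoint leaf sets, both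
non-constant, `|S₁| ≤ |S₂|` (so `|S₁| < 2^{|J|-1}`; `heart`): pick `μ ∈ vars P` (`∉ vars Q`),
decompose `P = T(x_μ) A + B` (`A ≠ 0`, `deg T ≥ 1`); if `(P + Q) ∘ G_J = κ` then `hσ` and `hτ` give
`T(g + λ) a + b + q = κ = T(g) a + b + q` (`g = G_{J∖j₀} μ`, `a = A ∘ G_{J∖j₀}`, …,
`MvPolynomial.eval₂Hom_congr'` for the `μ`-free `A, B, Q`), so `(T(g + λ) − T(g)) · a = 0`; `hρ` shows
the first factor is nonzero (`T(y_μ + X) − T(y_μ)` has degree `deg T`), so `a = 0`, contradicting the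
induction hypothesis for `A` with `|J| − 1` seeds. Axioms: `propext`, `Classical.choice`, `Quot.sound`.

References: [ShpilkaVolkovich2015] A. Shpilka, I. Volkovich, Read-once polynomial identity testing,
Comput. Complexity 24 (2015) 477–532, Thm. 1, §5; [MinahanVolkovich2017] D. Minahan, I. Volkovich,
CCC 2017 (LIPIcs 79) 32, Def. 12, Lemma 13.
-/

-- layout Summits/ValiantsHypothesis/ValiantsHypothesis forces the duplicated namespace component
set_option linter.dupNamespace false

namespace Summit.ValiantsHypothesis.ValiantsHypothesis.Theorems.BarrierLever.SuccinctHittingSetsForVP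

open Literature.Barriers.ValiantsHypothesis Literature.Computability.AlgebraicComplexity MvPolynomial

namespace ReadOnceGenerator

/-! ### Structure of preprocessed read-once polynomials: decomposition at a variable -/

section Structure

variable {R : Type*} [CommSemiring R] {ι : Type*} [DecidableEq ι]

/-- **Decomposition at a variable.** A preprocessed read-once polynomial `P` on the leaves `S`
splits, for every variable `μ`, as `P = T(x_μ) · A + B` with `A`, `B` preprocessed read-once on leaf
sets inside `S ∖ {μ}` (so `A`, `B` are free of `x_μ`); `T` is the leaf of `μ` (or anything if `μ` is
not a leaf). [cite: MinahanVolkovich2017, Lemma 13] -/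
theorem decomp {S : Finset ι} {P : MvPolynomial ι R} (h : IsPROP S P) (μ : ι) :
    ∃ (T : Polynomial R) (A B : MvPolynomial ι R) (SA SB : Finset ι),
      SA ⊆ S.erase μ ∧ SB ⊆ S.erase μ ∧ IsPROP SA A ∧ IsPROP SB B ∧
        P = Polynomial.aeval (X μ : MvPolynomial ι R) T * A + B := by
  induction h with
  | const a =>
      exact ⟨0, C 0, C a, ∅, ∅, Finset.empty_subset _, Finset.empty_subset _, IsPROP.const 0,
        IsPROP.const a, by simp⟩
  | leaf ν T =>
      by_cases hν : ν = μ
      · subst hν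
        exact ⟨T, C 1, C 0, ∅, ∅, Finset.empty_subset _, Finset.empty_subset _, IsPROP.const 1,
          IsPROP.const 0, by simp⟩
      · refine ⟨0, C 0, _, ∅, {ν}, Finset.empty_subset _, ?_, IsPROP.const 0, IsPROP.leaf ν T,
          by simp⟩
        rw [Finset.erase_eq_of_notMem (by rw [Finset.mem_singleton]; exact fun h => hν h.symm)]
  | @add S₁ S₂ P Q h₁ h₂ hdisj ih₁ ih₂ =>
      by_cases hμ : μ ∈ S₁
      · have hμ₂ : μ ∉ S₂ := Finset.disjoint_left.mp hdisj hμ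
        obtain ⟨T, A, B, SA, SB, hSA, hSB, hA, hB, hP⟩ := ih₁
        refine ⟨T, A, B + Q, SA, SB ∪ S₂,
          hSA.trans (Finset.erase_subset_erase μ Finset.subset_union_left),
          Finset.union_subset (hSB.trans (Finset.erase_subset_erase μ Finset.subset_union_left))
            ((Finset.erase_eq_of_notMem hμ₂).symm.trans_subset
              (Finset.erase_subset_erase μ Finset.subset_union_right)),
          hA, IsPROP.add hB h₂
            (Finset.disjoint_of_subset_left (hSB.trans (Finset.erase_subset μ S₁)) hdisj), ?_⟩
        rw [hP, add_assoc]
      · obtain ⟨T, A, B, SA, SB, hSA, hSB, hA, hB, hQ⟩ := ih₂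
        refine ⟨T, A, P + B, SA, S₁ ∪ SB,
          hSA.trans (Finset.erase_subset_erase μ Finset.subset_union_right),
          Finset.union_subset
            ((Finset.erase_eq_of_notMem hμ).symm.trans_subset
              (Finset.erase_subset_erase μ Finset.subset_union_left))
            (hSB.trans (Finset.erase_subset_erase μ Finset.subset_union_right)),
          hA, IsPROP.add h₁ hB
            (Finset.disjoint_of_subset_right (hSB.trans (Finset.erase_subset μ S₂)) hdisj), ?_⟩
        rw [hQ, add_left_comm]
  | @mul S₁ S₂ P Q h₁ h₂ hdisj ih₁ ih₂ =>
      by_cases hμ : μ ∈ S₁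
      · have hμ₂ : μ ∉ S₂ := Finset.disjoint_left.mp hdisj hμ
        obtain ⟨T, A, B, SA, SB, hSA, hSB, hA, hB, hP⟩ := ih₁
        have h₂' : S₂ ⊆ (S₁ ∪ S₂).erase μ :=
          (Finset.erase_eq_of_notMem hμ₂).symm.trans_subset
            (Finset.erase_subset_erase μ Finset.subset_union_right)
        refine ⟨T, A * Q, B * Q, SA ∪ S₂, SB ∪ S₂,
          Finset.union_subset (hSA.trans (Finset.erase_subset_erase μ Finset.subset_union_left)) h₂',
          Finset.union_subset (hSB.trans (Finset.erase_subset_erase μ Finset.subset_union_left)) h₂',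
          IsPROP.mul hA h₂
            (Finset.disjoint_of_subset_left (hSA.trans (Finset.erase_subset μ S₁)) hdisj),
          IsPROP.mul hB h₂
            (Finset.disjoint_of_subset_left (hSB.trans (Finset.erase_subset μ S₁)) hdisj), ?_⟩
        rw [hP, add_mul, mul_assoc]
      · obtain ⟨T, A, B, SA, SB, hSA, hSB, hA, hB, hQ⟩ := ih₂
        have h₁' : S₁ ⊆ (S₁ ∪ S₂).erase μ :=
          (Finset.erase_eq_of_notMem hμ).symm.trans_subset
            (Finset.erase_subset_erase μ Finset.subset_union_left)
        refine ⟨T, P * A, P * B, S₁ ∪ SA, S₁ ∪ SB,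
          Finset.union_subset h₁' (hSA.trans (Finset.erase_subset_erase μ Finset.subset_union_right)),
          Finset.union_subset h₁' (hSB.trans (Finset.erase_subset_erase μ Finset.subset_union_right)),
          IsPROP.mul h₁ hA
            (Finset.disjoint_of_subset_right (hSA.trans (Finset.erase_subset μ S₂)) hdisj),
          IsPROP.mul h₁ hB
            (Finset.disjoint_of_subset_right (hSB.trans (Finset.erase_subset μ S₂)) hdisj), ?_⟩
        rw [hQ, mul_add, mul_left_comm]

end Structure

/-! ### Univariate: `T(c + X)` has the degree of `T` -/

/-- `deg T(c + X) = deg T` (a Taylor shift). [folklore] -/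
theorem natDegree_aeval_C_add_X {R : Type*} [CommRing R] (c : R) (T : Polynomial R) :
    (Polynomial.aeval (Polynomial.C c + Polynomial.X) T).natDegree = T.natDegree := by
  rw [← Polynomial.comp_eq_aeval, add_comm, ← Polynomial.taylor_apply, Polynomial.natDegree_taylor]

/-- `deg (T(c + X) − T(c)) = deg T`. [folklore] -/
theorem natDegree_aeval_C_add_X_sub {R : Type*} [CommRing R] (c : R) (T : Polynomial R) :
    (Polynomial.aeval (Polynomial.C c + Polynomial.X) T -
        Polynomial.aeval (Polynomial.C c) T).natDegree = T.natDegree := by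
  rw [← Polynomial.comp_eq_aeval (p := T) (q := Polynomial.C c), Polynomial.comp_C,
    Polynomial.natDegree_sub_C, natDegree_aeval_C_add_X]

/-! ### The Shpilka–Volkovich induction for an abstract seeded generator family

`G J : ι → ℂ[V]` (`J : Finset K` the active seeds), `lam j ∈ ℂ[V]` the seed variables, with the
three specialisation properties `hσ` (axis of one seed), `hτ` (kill one seed), `hρ` (send a fresh
seed variable to `X` and everything else to scalars). -/

section Abstract

variable {ι : Type*} [DecidableEq ι] {K : Type*} [DecidableEq K] {V : Type*} {y : ι → ℂ}
  {G : Finset K → ι → MvPolynomial V ℂ} {lam : K → MvPolynomial V ℂ}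

/-- **The sum gate (heart of Shpilka–Volkovich's induction).** With `k + 1` active seeds, if the claim
holds for `k` seeds, `P`, `Q` are read-once on disjoint leaf sets of total size `< 2^{k+1}`,
`|S₁| ≤ |S₂|` and `P ∘ G_J` is non-constant, then `(P + Q) ∘ G_J` is non-constant.
[cite: ShpilkaVolkovich2015, Thm. 1] -/
theorem heart
    (hσ : ∀ (J : Finset K) (j₀ : K), j₀ ∈ J → ∀ μ₀ : ι,
      ∃ σ : MvPolynomial V ℂ →ₐ[ℂ] MvPolynomial V ℂ,
        ∀ ν, σ (G J ν) = G (J.erase j₀) ν + if ν = μ₀ then lam j₀ else 0)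
    (hτ : ∀ (J : Finset K) (j₀ : K), j₀ ∈ J →
      ∃ τ : MvPolynomial V ℂ →ₐ[ℂ] MvPolynomial V ℂ, ∀ ν, τ (G J ν) = G (J.erase j₀) ν)
    (hρ : ∀ (J : Finset K) (j₀ : K), j₀ ∉ J → ∃ ρ : MvPolynomial V ℂ →ₐ[ℂ] Polynomial ℂ,
      (∀ ν, ρ (G J ν) = Polynomial.C (y ν)) ∧ ρ (lam j₀) = Polynomial.X)
    {k : ℕ}
    (IH : ∀ J' : Finset K, J'.card = k → ∀ {S : Finset ι} {A : MvPolynomial ι ℂ},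
      IsPROP S A → S.card < 2 ^ k → (∃ a, A = C a) ∨ (aeval (G J') A).totalDegree ≠ 0)
    {J : Finset K} (hJ : J.card = k + 1) {S₁ S₂ : Finset ι} {P Q : MvPolynomial ι ℂ}
    (h₁ : IsPROP S₁ P) (h₂ : IsPROP S₂ Q) (hdisj : Disjoint S₁ S₂)
    (hS : (S₁ ∪ S₂).card < 2 ^ (k + 1)) (hle : S₁.card ≤ S₂.card)
    (hP : (aeval (G J) P).totalDegree ≠ 0) :
    (aeval (G J) (P + Q)).totalDegree ≠ 0 := by
  intro hdeg
  rw [totalDegree_eq_zero_iff_eq_C] at hdeg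
  generalize coeff 0 (aeval (G J) (P + Q)) = κ at hdeg
  -- a variable `μ` of `P`; it is not a variable of `Q`
  obtain ⟨μ, hμP⟩ : ∃ μ, μ ∈ P.vars := by
    by_contra hcon
    push Not at hcon
    apply hP
    rw [vars_eq_empty_iff_eq_C.mp (Finset.eq_empty_of_forall_notMem hcon), aeval_C, algebraMap_eq,
      totalDegree_C]
  have hμS₁ : μ ∈ S₁ := h₁.vars_subset hμP
  have hμS₂ : μ ∉ S₂ := Finset.disjoint_left.mp hdisj hμS₁
  have hμQ : μ ∉ Q.vars := fun h => hμS₂ (h₂.vars_subset h)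
  -- decomposition `P = T(x_μ) A + B`, `A`, `B` free of `x_μ`
  obtain ⟨T, A, B, SA, SB, hSA, hSB, hA, hB, hPeq⟩ := decomp h₁ μ
  have hμA : μ ∉ A.vars := fun h => by simpa using hSA (hA.vars_subset h)
  have hμB : μ ∉ B.vars := fun h => by simpa using hSB (hB.vars_subset h)
  have hA0 : A ≠ 0 := by
    rintro rfl
    rw [mul_zero, zero_add] at hPeq
    exact hμB (hPeq ▸ hμP)
  have hT : T.natDegree ≠ 0 := by
    intro hT0
    rw [Polynomial.eq_C_of_natDegree_eq_zero hT0, Polynomial.aeval_C, algebraMap_eq] at hPeq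
    rcases Finset.mem_union.mp (vars_add_subset _ _ (hPeq ▸ hμP)) with h | h
    · rcases Finset.mem_union.mp (vars_mul _ _ h) with h' | h'
      · rw [vars_C] at h'
        exact Finset.notMem_empty μ h'
      · exact hμA h'
    · exact hμB h
  -- the seed to be specialised, and the cardinality budget of `A`
  obtain ⟨j₀, hj₀⟩ := Finset.card_pos.mp (by omega : 0 < J.card)
  have hJ' : (J.erase j₀).card = k := by
    rw [Finset.card_erase_of_mem hj₀, hJ, Nat.add_sub_cancel]
  have hSAk : SA.card < 2 ^ k := by
    have h1 := Finset.card_le_card hSA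
    rw [Finset.card_erase_of_mem hμS₁] at h1
    have h2 := Finset.card_union_of_disjoint hdisj
    have h3 : 0 < S₁.card := Finset.card_pos.mpr ⟨μ, hμS₁⟩
    rw [pow_succ] at hS
    omega
  have ha0 : aeval (G (J.erase j₀)) A ≠ 0 := by
    rcases IH (J.erase j₀) hJ' hA hSAk with ⟨a, rfl⟩ | hdegA
    · rw [aeval_C, algebraMap_eq, Ne, C_eq_zero]
      rintro rfl
      exact hA0 C_0
    · exact fun h0 => hdegA (by rw [h0, totalDegree_zero])
  -- the three specialisations
  obtain ⟨σ, hσG⟩ := hσ J j₀ hj₀ μ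
  obtain ⟨τ, hτG⟩ := hτ J j₀ hj₀
  obtain ⟨ρ, hρG, hρlam⟩ := hρ (J.erase j₀) j₀ (Finset.notMem_erase j₀ J)
  have hfree : ∀ R : MvPolynomial ι ℂ, μ ∉ R.vars →
      aeval (fun ν => σ (G J ν)) R = aeval (G (J.erase j₀)) R := by
    intro R hR
    rw [aeval_eq_eval₂Hom, aeval_eq_eval₂Hom]
    refine eval₂Hom_congr' rfl (fun ν hν _ => ?_) rfl
    rw [hσG, if_neg (fun h : ν = μ => hR (h ▸ hν)), add_zero]
  -- axis specialisation of seed `j₀` at `μ`: `T(g + λ) a + b + q = κ`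
  have hstar : Polynomial.aeval (G (J.erase j₀) μ + lam j₀) T * aeval (G (J.erase j₀)) A +
      aeval (G (J.erase j₀)) B + aeval (G (J.erase j₀)) Q = C κ := by
    have h := congrArg σ hdeg
    rw [algHom_C, algebraMap_eq, comp_aeval_apply, hPeq, map_add, map_add, map_mul, hfree A hμA,
      hfree B hμB, hfree Q hμQ, ← Polynomial.aeval_algHom_apply, aeval_X, hσG, if_pos rfl] at h
    exact h
  -- killing seed `j₀`: `T(g) a + b + q = κ`
  have hstar₂ : Polynomial.aeval (G (J.erase j₀) μ) T * aeval (G (J.erase j₀)) A +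
      aeval (G (J.erase j₀)) B + aeval (G (J.erase j₀)) Q = C κ := by
    have h := congrArg τ hdeg
    have hfun : (fun ν => τ (G J ν)) = G (J.erase j₀) := funext hτG
    rw [algHom_C, algebraMap_eq, comp_aeval_apply, hfun, hPeq, map_add, map_add, map_mul,
      ← Polynomial.aeval_algHom_apply, aeval_X] at h
    exact h
  have hprod : (Polynomial.aeval (G (J.erase j₀) μ + lam j₀) T -
      Polynomial.aeval (G (J.erase j₀) μ) T) * aeval (G (J.erase j₀)) A = 0 := by
    linear_combination hstar - hstar₂
  rcases mul_eq_zero.mp hprod with h0 | h0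
  · -- the first factor has `λ`-degree `deg T ≥ 1`: send `λ ↦ X`, the rest to scalars
    have h := congrArg ρ h0
    rw [map_sub, map_zero, ← Polynomial.aeval_algHom_apply, ← Polynomial.aeval_algHom_apply,
      map_add, hρG, hρlam] at h
    apply hT
    rw [← natDegree_aeval_C_add_X_sub (y μ) T, h, Polynomial.natDegree_zero]
  · exact ha0 h0

/-- **The claim, by induction on the number of active seeds and then on the formula**: with `k`
active seeds, a preprocessed read-once `P` on `< 2^k` leaves is a constant or has non-constant
image `P ∘ G_J`. [cite: ShpilkaVolkovich2015, Thm. 1] -/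
theorem core_aux
    (hσ : ∀ (J : Finset K) (j₀ : K), j₀ ∈ J → ∀ μ₀ : ι,
      ∃ σ : MvPolynomial V ℂ →ₐ[ℂ] MvPolynomial V ℂ,
        ∀ ν, σ (G J ν) = G (J.erase j₀) ν + if ν = μ₀ then lam j₀ else 0)
    (hτ : ∀ (J : Finset K) (j₀ : K), j₀ ∈ J →
      ∃ τ : MvPolynomial V ℂ →ₐ[ℂ] MvPolynomial V ℂ, ∀ ν, τ (G J ν) = G (J.erase j₀) ν)
    (hρ : ∀ (J : Finset K) (j₀ : K), j₀ ∉ J → ∃ ρ : MvPolynomial V ℂ →ₐ[ℂ] Polynomial ℂ,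
      (∀ ν, ρ (G J ν) = Polynomial.C (y ν)) ∧ ρ (lam j₀) = Polynomial.X)
    (k : ℕ) :
    ∀ J : Finset K, J.card = k → ∀ {S : Finset ι} {P : MvPolynomial ι ℂ}, IsPROP S P →
      S.card < 2 ^ k → (∃ a, P = C a) ∨ (aeval (G J) P).totalDegree ≠ 0 := by
  induction k with
  | zero =>
      intro J _ S P h hS
      rw [pow_zero, Nat.lt_one_iff, Finset.card_eq_zero] at hS
      subst hS
      exact Or.inl ⟨P.coeff 0, vars_eq_empty_iff_eq_C.mp (Finset.subset_empty.mp h.vars_subset)⟩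
  | succ k IHk =>
      intro J hJ S P h
      induction h with
      | const a => exact fun _ => Or.inl ⟨a, rfl⟩
      | leaf μ T =>
          intro _
          by_cases hT : T.natDegree = 0
          · refine Or.inl ⟨T.coeff 0, ?_⟩
            conv_lhs => rw [Polynomial.eq_C_of_natDegree_eq_zero hT]
            rw [Polynomial.aeval_C, algebraMap_eq]
          · right
            intro hdeg
            rw [totalDegree_eq_zero_iff_eq_C] at hdeg
            generalize coeff 0 (aeval (G J) (Polynomial.aeval (X μ : MvPolynomial ι ℂ) T)) = κ
              at hdeg
            obtain ⟨j₀, hj₀⟩ := Finset.card_pos.mp (by omega : 0 < J.card)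
            obtain ⟨σ, hσG⟩ := hσ J j₀ hj₀ μ
            obtain ⟨ρ, hρG, hρlam⟩ := hρ (J.erase j₀) j₀ (Finset.notMem_erase j₀ J)
            -- axis specialisation, then `λ ↦ X`: `T(y_μ + X) = κ`, absurd as `deg T ≥ 1`
            have h := congrArg (fun q => ρ (σ q)) hdeg
            rw [algHom_C, algebraMap_eq, algHom_C, Polynomial.algebraMap_eq,
              ← Polynomial.aeval_algHom_apply, aeval_X, ← Polynomial.aeval_algHom_apply, hσG,
              if_pos rfl, ← Polynomial.aeval_algHom_apply, map_add, hρG, hρlam] at h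
            apply hT
            rw [← natDegree_aeval_C_add_X (y μ) T, h, Polynomial.natDegree_C]
      | @add S₁ S₂ P Q h₁ h₂ hdisj ih₁ ih₂ =>
          intro hS
          have hS₁ : S₁.card < 2 ^ (k + 1) :=
            lt_of_le_of_lt (Finset.card_le_card Finset.subset_union_left) hS
          have hS₂ : S₂.card < 2 ^ (k + 1) :=
            lt_of_le_of_lt (Finset.card_le_card Finset.subset_union_right) hS
          rcases ih₁ hS₁ with ⟨a, rfl⟩ | hP
          · rcases ih₂ hS₂ with ⟨b, rfl⟩ | hQ
            · exact Or.inl ⟨a + b, by rw [C_add]⟩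
            · right
              rw [map_add, aeval_C, algebraMap_eq, totalDegree_add_eq_right_of_totalDegree_lt]
              · exact hQ
              · rw [totalDegree_C]
                exact Nat.pos_of_ne_zero hQ
          · rcases ih₂ hS₂ with ⟨b, rfl⟩ | hQ
            · right
              rw [map_add, aeval_C, algebraMap_eq, totalDegree_add_eq_left_of_totalDegree_lt]
              · exact hP
              · rw [totalDegree_C]
                exact Nat.pos_of_ne_zero hP
            · right
              rcases le_total S₁.card S₂.card with hle | hle
              · exact heart hσ hτ hρ IHk hJ h₁ h₂ hdisj hS hle hP
              · have h := heart hσ hτ hρ IHk hJ h₂ h₁ hdisj.symm (by rwa [Finset.union_comm]) hle hQ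
                rwa [add_comm] at h
      | @mul S₁ S₂ P Q h₁ h₂ hdisj ih₁ ih₂ =>
          intro hS
          have hS₁ : S₁.card < 2 ^ (k + 1) :=
            lt_of_le_of_lt (Finset.card_le_card Finset.subset_union_left) hS
          have hS₂ : S₂.card < 2 ^ (k + 1) :=
            lt_of_le_of_lt (Finset.card_le_card Finset.subset_union_right) hS
          rcases ih₁ hS₁ with ⟨a, rfl⟩ | hP
          · rcases ih₂ hS₂ with ⟨b, rfl⟩ | hQ
            · exact Or.inl ⟨a * b, by rw [C_mul]⟩
            · by_cases ha : a = 0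
              · exact Or.inl ⟨0, by rw [ha, C_0, zero_mul]⟩
              · right
                rw [map_mul, aeval_C, algebraMap_eq,
                  totalDegree_mul_of_isDomain (C_ne_zero.mpr ha)
                    (fun h0 => hQ (by rw [h0, totalDegree_zero])), totalDegree_C, zero_add]
                exact hQ
          · rcases ih₂ hS₂ with ⟨b, rfl⟩ | hQ
            · by_cases hb : b = 0
              · exact Or.inl ⟨0, by rw [hb, C_0, mul_zero]⟩
              · right
                rw [map_mul, aeval_C, algebraMap_eq,
                  totalDegree_mul_of_isDomain (fun h0 => hP (by rw [h0, totalDegree_zero]))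
                    (C_ne_zero.mpr hb), totalDegree_C, add_zero]
                exact hP
            · right
              rw [map_mul, totalDegree_mul_of_isDomain (fun h0 => hP (by rw [h0, totalDegree_zero]))
                (fun h0 => hQ (by rw [h0, totalDegree_zero]))]
              omega

/-- **Shpilka–Volkovich's theorem for an abstract seeded generator.** If `|S| < 2^{|J|}`, a
preprocessed read-once `P` on the leaves `S` is a constant or `P ∘ G_J` is non-constant.
[cite: ShpilkaVolkovich2015, Thm. 1] -/
theorem core
    (hσ : ∀ (J : Finset K) (j₀ : K), j₀ ∈ J → ∀ μ₀ : ι,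
      ∃ σ : MvPolynomial V ℂ →ₐ[ℂ] MvPolynomial V ℂ,
        ∀ ν, σ (G J ν) = G (J.erase j₀) ν + if ν = μ₀ then lam j₀ else 0)
    (hτ : ∀ (J : Finset K) (j₀ : K), j₀ ∈ J →
      ∃ τ : MvPolynomial V ℂ →ₐ[ℂ] MvPolynomial V ℂ, ∀ ν, τ (G J ν) = G (J.erase j₀) ν)
    (hρ : ∀ (J : Finset K) (j₀ : K), j₀ ∉ J → ∃ ρ : MvPolynomial V ℂ →ₐ[ℂ] Polynomial ℂ,
      (∀ ν, ρ (G J ν) = Polynomial.C (y ν)) ∧ ρ (lam j₀) = Polynomial.X)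
    {S : Finset ι} {P : MvPolynomial ι ℂ} (h : IsPROP S P) (J : Finset K)
    (hS : S.card < 2 ^ J.card) : (∃ a, P = C a) ∨ (aeval (G J) P).totalDegree ≠ 0 :=
  core_aux hσ hτ hρ J.card J rfl h hS

end Abstract

end ReadOnceGenerator

/-- **Registered stub `stub_readOnceCore`** (crux stmt-ValiantsHypothesis-14610, line `registered`):
Shpilka–Volkovich's theorem for an abstract seeded generator family with the axis / kill / fresh-seed
specialisations — verbatim `ReadOnceGenerator.core`. [cite: ShpilkaVolkovich2015, Thm. 1] -/
theorem stub_readOnceCore :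
    ∀ (ι : Type) [DecidableEq ι] (K : Type) [DecidableEq K] (V : Type) (y : ι → ℂ)
      (G : Finset K → ι → MvPolynomial V ℂ) (lam : K → MvPolynomial V ℂ),
      (∀ (J : Finset K) (j₀ : K), j₀ ∈ J → ∀ μ₀ : ι,
        ∃ σ : MvPolynomial V ℂ →ₐ[ℂ] MvPolynomial V ℂ,
          ∀ ν, σ (G J ν) = G (J.erase j₀) ν + if ν = μ₀ then lam j₀ else 0) →
      (∀ (J : Finset K) (j₀ : K), j₀ ∈ J →
        ∃ τ : MvPolynomial V ℂ →ₐ[ℂ] MvPolynomial V ℂ, ∀ ν, τ (G J ν) = G (J.erase j₀) ν) →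
      (∀ (J : Finset K) (j₀ : K), j₀ ∉ J → ∃ ρ : MvPolynomial V ℂ →ₐ[ℂ] Polynomial ℂ,
        (∀ ν, ρ (G J ν) = Polynomial.C (y ν)) ∧ ρ (lam j₀) = Polynomial.X) →
      ∀ (S : Finset ι) (P : MvPolynomial ι ℂ), IsPROP S P → ∀ J : Finset K,
        S.card < 2 ^ J.card →
          (∃ a, P = MvPolynomial.C a) ∨ (MvPolynomial.aeval (G J) P).totalDegree ≠ 0 :=
  fun _ _ _ _ _ _ _ _ hσ hτ hρ _ _ h J hS => ReadOnceGenerator.core hσ hτ hρ h J hS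

end Summit.ValiantsHypothesis.ValiantsHypothesis.Theorems.BarrierLever.SuccinctHittingSetsForVP
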